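import Summits.AnomalousDissipation.AnomalousDissipation.Theorems.TaylorCertificatesFloorCertificateStubMinimaxAlternative
import Summits.AnomalousDissipation.AnomalousDissipation.Theorems.TaylorCertificatesFloorCertificateStubPenalisationLimit
import Summits.AnomalousDissipation.AnomalousDissipation.Theorems.TaylorCertificatesFloorCertificateStubFanMinimax
import Summits.AnomalousDissipation.AnomalousDissipation.Theorems.TaylorCertificatesFloorCertificateStubLscEnstrophy
import Summits.AnomalousDissipation.AnomalousDissipation.Theorems.TaylorCertificatesFloorCertificateStubSublevelCompact
import Summits.AnomalousDissipation.AnomalousDissipation.Theorems.TaylorCertificatesFloorCertificateStubCylindricalCombination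

/-!
# Stub `stub_floorOfRelaxedFloor` (T1) of the line `Sketch`
# (crux stmt-AnomalousDissipation-14086, `TaylorCertificates.FloorCertificateEnsembleCeiling`)

STRONG DUALITY FOR THE DISSIPATION FLOOR AT ONE VISCOSITY. A floor CERTIFICATE at `(f, ν)` with
budget `ε` is a cylindrical test functional `Φ₁` and a constant weight `θ₁ ≤ 0` with
`ε ≤ ν‖∇u‖² + ⟨F(u), Φ₁'(u)⟩ + 2θ₁((u,f) − ν‖∇u‖²)` at every finite-enstrophy state `u` of the
Leray ball `|u|² ≤ 16‖f‖²/ν²`. Its Lagrangian dual objects are the RELAXED STATIONARY STATISTICS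
of `NS_ν(f)`: Borel probability measures `μ` on the energy space `H` carried by the ball, of
finite mean enstrophy, annihilating every cylindrical Liouville functional
(`∫ ⟨F(u), Φ'(u)⟩ dμ = 0`), with integrable work `(u,f)` and the global mean energy inequality
`ε(μ) := Torus.ensembleDissipation ν μ ≤ ∫ (u,f) dμ`.

The theorem: if every relaxed stationary statistic dissipates at least `ε₀ > 0` in the mean
(uniform loudness), then a floor certificate with budget `ε₀/2` exists (`ν > 0`, `f` smooth).

Proof (composition of the LANDED sibling stubs of `TaylorCertificatesFloorCertificate`). Suppose
no certificate with budget `ε₀/2` exists. For every `n : ℕ` apply the minimax alternative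
`stub_minimaxAlternative` — fed the landed S0 `stub_lscEnstrophy` (lower semicontinuity of the
mean enstrophy), S1 `stub_sublevelCompact` (compact dissipation sublevel sets), S2
`stub_fanMinimax` (Ky Fan 1953, Thm 2) and S3a `stub_cylindricalCombination` — at slope `L = n`,
level `γ = 3ε₀/4` and slack `η = ε₀/8`. Its first horn is a slope-`n` multiplier certifying the
floor with budget `γ − η = 5ε₀/8 ≥ ε₀/2`, excluded by monotonicity of the floor in the budget; so
its second horn yields an `(n, 7ε₀/8)`-approximately relaxed statistic `μₙ`. The penalisation
limit `stub_penalisationLimit` of `(μₙ)` is a relaxed stationary statistic with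
`ε(μ) ≤ 7ε₀/8 < ε₀ ≤ ε(μ)` — contradiction.

References: Ky Fan, *Minimax theorems*, PNAS 39 (1953) 42–47, Thm 2; Foias–Manley–Rosa–Temam
(2001), Ch. IV §1.2 and Ch. V §1 (stationary statistical solutions, mean dissipation).
-/

noncomputable section

set_option linter.dupNamespace false

namespace Summit.AnomalousDissipation.AnomalousDissipation.Theorems.TaylorCertificatesFloorCertificateEnsembleCeiling

open MeasureTheory Filter Topology
open Literature.Analysis.FunctionSpaces Literature.Analysis.FluidPDE
open scoped ENNReal
open Summit.AnomalousDissipation.AnomalousDissipation.Theorems.FloorCertificate.Negative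

/-- Local notation: real vector fields on `T³`. -/
local notation "Vec3" => (UnitAddTorus (Fin 3)) → (EuclideanSpace ℝ (Fin 3))
/-- Local notation: `L²(T³; ℝ³)`. -/
local notation "L2" => (Lp (EuclideanSpace ℝ (Fin 3)) 2 (volume : Measure (UnitAddTorus (Fin 3))))
/-- Local notation: the energy space `H`. -/
local notation "H3" => (Torus.energySpace (Fin 3))

/-- **Strong duality for the floor at one viscosity.** If every RELAXED stationary statistic of
`NS_ν(f)` on the Leray ball (probability measure carried by the ball, finite mean enstrophy, all
cylindrical Liouville identities, integrable work, global energy inequality) dissipates at least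
`ε₀ > 0` in the mean, then some cylindrical `Φ₁` and `θ₁ ≤ 0` certify the floor with budget `ε₀/2`
at every finite-enstrophy state of the ball. Otherwise, for every `n` the landed minimax
alternative `TaylorCertificatesFloorCertificate.stub_minimaxAlternative` (fed the landed
`stub_lscEnstrophy`, `stub_sublevelCompact`, `stub_fanMinimax`, `stub_cylindricalCombination`) at
`(L, γ, η) = (n, 3ε₀/4, ε₀/8)` cannot take its first horn (a certificate with budget
`5ε₀/8 ≥ ε₀/2`), so it yields `(n, 7ε₀/8)`-approximately relaxed statistics, whose landed
penalisation limit `stub_penalisationLimit` is a relaxed statistic with `ε ≤ 7ε₀/8 < ε₀`. -/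
theorem stub_floorOfRelaxedFloor :
    ∀ (ν : ℝ) (f : Vec3) (ε₀ : ℝ), 0 < ν → Torus.IsSmooth f → 0 < ε₀ →
      (∀ μ : Measure H3,
        IsProbabilityMeasure μ →
        (∀ᵐ u ∂μ, ‖u‖ ^ 2 ≤ 16 * (∫ x, ‖f x‖ ^ 2) / ν ^ 2) →
        Torus.ensembleEnstrophy μ < ⊤ →
        (∀ Φ : Torus.CylindricalTest (Fin 3),
          Integrable (fun u => Torus.nsGeneratorPairing ν f u (Φ.grad u)) μ ∧
            ∫ u, Torus.nsGeneratorPairing ν f u (Φ.grad u) ∂μ = 0) →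
        Integrable (fun u : H3 => Torus.pairing (u : L2) f) μ →
        Torus.ensembleDissipation ν μ ≤ ∫ u, Torus.pairing (u : L2) f ∂μ →
        ε₀ ≤ Torus.ensembleDissipation ν μ) →
      ∃ (Φ₁ : Torus.CylindricalTest (Fin 3)) (θ₁ : ℝ), θ₁ ≤ 0 ∧
        ∀ u : H3, Torus.eGradNormSq ((u : L2) : Vec3) ≠ ⊤ → ‖u‖ ^ 2 ≤ 16 * (∫ x, ‖f x‖ ^ 2) / ν ^ 2 →
          ε₀ / 2 ≤ ν * (Torus.eGradNormSq ((u : L2) : Vec3)).toReal + Torus.nsGeneratorPairing ν f u (Φ₁.grad u) +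
            2 * θ₁ * (Torus.pairing (u : L2) f - ν * (Torus.eGradNormSq ((u : L2) : Vec3)).toReal) := by
  intro ν f ε₀ hν hfs hε₀ hloud
  by_contra hno
  -- for every slope `n`, the alternative at `(L, γ, η) = (n, 3ε₀/4, ε₀/8)` takes its second horn
  have hB := fun n : ℕ =>
    (TaylorCertificatesFloorCertificate.stub_minimaxAlternative
      TaylorCertificatesFloorCertificate.stub_lscEnstrophy
      (TaylorCertificatesFloorCertificate.stub_sublevelCompact
        TaylorCertificatesFloorCertificate.stub_lscEnstrophy)
      TaylorCertificatesFloorCertificate.stub_fanMinimax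
      TaylorCertificatesFloorCertificate.stub_cylindricalCombination ν f hν hfs n (3 * ε₀ / 4) (ε₀ / 8)
      (Nat.cast_nonneg n) (by positivity)).resolve_left fun ⟨Φ, θ, _, hθ0, _, hfloor⟩ =>
        hno ⟨Φ, θ, hθ0, fun u h1 h2 => le_trans (by linarith) (hfloor u h1 h2)⟩
  choose μs hμs using hB
  -- the penalisation limit of the approximately relaxed statistics is relaxed and too quiet
  obtain ⟨μ, ⟨hprob, hball, hZ, hLiou, hW, hE⟩, hdiss⟩ :=
    TaylorCertificatesFloorCertificate.stub_penalisationLimit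
      TaylorCertificatesFloorCertificate.stub_lscEnstrophy
      (TaylorCertificatesFloorCertificate.stub_sublevelCompact
        TaylorCertificatesFloorCertificate.stub_lscEnstrophy)
      TaylorCertificatesFloorCertificate.stub_cylindricalCombination ν f hν hfs _ μs hμs
  have h := hloud μ hprob hball hZ hLiou hW hE
  linarith

end Summit.AnomalousDissipation.AnomalousDissipation.Theorems.TaylorCertificatesFloorCertificateEnsembleCeiling
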